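import Literature.Topology.FourManifolds.DiscTheoremDiffeotopy
import Mathlib.Analysis.Normed.Module.Connected
import HarnessLib

/-!
# The disc theorem for two disjoint discs, with a compactly supported diffeotopy

Topic `Literature/Topology/FourManifolds` (fact seat
`provefact-Literature.Topology.FourManifolds.IsHandlebody.exists_isBoundaryGluing_sphere`, step F2b of
the Lickorish–Wallace DAG; fourth layer of the isotopy-tracked disc theorem: the two feet of a
`1`-handle are moved simultaneously).  Everything here is **proved**; no named facts.

Hirsch, *Differential Topology* (1976), Ch. 8 §3, Thm. 3.1 and Thm. 3.2 / Exercise 3 treat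
finitely many disjoint discs: "if `fᵢ, gᵢ : Dᵏ → M` are embeddings with disjoint images … there
is a diffeotopy of `M` carrying each `fᵢ` to `gᵢ`" (for `k = n` with matching orientations,
`M` connected of dimension `n ≥ 2`).  The case of **two** discs is derived here from the one-disc
theorem with support (`DiscTheoremDiffeotopy.lean`): move the first disc, then move the second
one by a diffeotopy supported in the complement of the (new) first disc, which is still
connected because removing a closed disc from a connected open set of dimension `≥ 2` does not
disconnect it.

* `isPreconnected_setOf_lt_norm` — `{y | r < ‖y‖}` is preconnected in dimension `≥ 2`;
* `IsPreconnected.diff_of_isPreconnected_diff` — removing a closed set with a good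
  neighbourhood from a preconnected set keeps it preconnected (the set version of the tree's
  punctured-neighbourhood criterion `isPreconnected_compl_singleton_of_puncturedNhd`);
* `isPreconnected_diff_image_closedBall` — `W ∖ i(B̄ⁿ)` is preconnected for a disc `i` in a
  preconnected `W`, `n ≥ 2`;
* `exists_isCompactlyDiffeotopicToIdIn_apply_two_discs_eq` — **two-disc theorem**: for discs
  `i₁, i₂` with disjoint images and `i₁', i₂'` with disjoint images in a preconnected open `W`
  of a Hausdorff `n`-manifold, `n ≥ 2`, all four equally oriented, there is a diffeomorphism
  `f`, compactly diffeotopic to the identity inside `W`, with `f ∘ i₁ = i₁'` and `f ∘ i₂ = i₂'`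
  on the closed unit ball.

## References

* M. W. Hirsch, *Differential Topology*, GTM 33 (1976), Ch. 8 §3, Thms. 3.1–3.2.
  [HirschDT1976]
-/

open scoped Manifold ContDiff Topology
open Set Module Function Filter Metric

noncomputable section

namespace Literature.Topology.FourManifolds

/-! ### Removing a disc does not disconnect -/

section Connected

/-- In a real normed space of dimension `≥ 2` the exterior `{y | r < ‖y‖}` of a ball (`0 ≤ r`)
is preconnected: it is the image of `S(0, 1) × (r, ∞)` under `(x, t) ↦ t • x`. [folklore] -/
theorem isPreconnected_setOf_lt_norm {E : Type*} [NormedAddCommGroup E] [NormedSpace ℝ E]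
    (h : 1 < Module.rank ℝ E) {r : ℝ} (hr : 0 ≤ r) : IsPreconnected {y : E | r < ‖y‖} := by
  have heq : {y : E | r < ‖y‖} = (fun p : E × ℝ => p.2 • p.1) '' (sphere (0 : E) 1 ×ˢ Ioi r) := by
    ext y
    simp only [mem_setOf_eq, mem_image, mem_prod, mem_sphere_iff_norm, sub_zero, mem_Ioi,
      Prod.exists]
    constructor
    · intro hy
      have hy0 : 0 < ‖y‖ := hr.trans_lt hy
      refine ⟨‖y‖⁻¹ • y, ‖y‖, ⟨?_, hy⟩, ?_⟩
      · rw [norm_smul, norm_inv, norm_norm, inv_mul_cancel₀ hy0.ne']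
      · rw [smul_smul, mul_inv_cancel₀ hy0.ne', one_smul]
    · rintro ⟨x, t, ⟨hx, ht⟩, rfl⟩
      rw [norm_smul, hx, mul_one, Real.norm_of_nonneg (hr.trans ht.le)]
      exact ht
  rw [heq]
  exact ((isPreconnected_sphere h 0 1).prod isPreconnected_Ioi).image _
    (continuous_snd.smul continuous_fst).continuousOn

variable {X : Type*} [TopologicalSpace X]

/-- **Removing a closed set with a good neighbourhood keeps a preconnected set preconnected**:
if `D` is closed, `D ⊆ U ⊆ W` with `U` open and `U ∖ D` preconnected, and `W` is
preconnected, then so is `W ∖ D` (a separation `W ∖ D = u ⊔ v` with `U ∖ D ⊆ u` gives the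
separation `W ⊆ ((u ∖ D) ∪ U) ⊔ (v ∖ D)` of `W`; the set version of the punctured-neighbourhood
criterion `isPreconnected_compl_singleton_of_puncturedNhd`). [folklore] -/
theorem IsPreconnected.diff_of_isPreconnected_diff {W U D : Set X} (hW : IsPreconnected W)
    (hD : IsClosed D) (hU : IsOpen U) (hDU : D ⊆ U) (hUW : U ⊆ W) (hS : IsPreconnected (U \ D)) :
    IsPreconnected (W \ D) := by
  rw [isPreconnected_iff_subset_of_disjoint] at hW hS ⊢
  intro u v hu hv huv hdisj
  have hSuv : U \ D ⊆ u ∪ v := fun x hx => huv ⟨hUW hx.1, hx.2⟩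
  have hSdisj : (U \ D) ∩ (u ∩ v) = ∅ := by
    apply Set.eq_empty_of_subset_empty
    rw [← hdisj]
    exact inter_subset_inter_left _ fun x hx => ⟨hUW hx.1, hx.2⟩
  -- wlog `U \ D ⊆ u` (the other case is symmetric)
  rcases hS u v hu hv hSuv hSdisj with hSu | hSv
  · -- separation of `W` by `(u \ D) ∪ U` and `v \ D`
    have h := hW ((u \ D) ∪ U) (v \ D) ((hu.sdiff hD).union hU) (hv.sdiff hD) ?_ ?_
    · rcases h with h | h
      · left
        intro x hx
        rcases h hx.1 with h1 | h1
        · exact h1.1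
        · exact hSu ⟨h1, hx.2⟩
      · right
        exact fun x hx => (h hx.1).1
    · intro x hxW
      by_cases hxD : x ∈ D
      · exact Or.inl (Or.inr (hDU hxD))
      · rcases huv ⟨hxW, hxD⟩ with h1 | h1
        · exact Or.inl (Or.inl ⟨h1, hxD⟩)
        · exact Or.inr ⟨h1, hxD⟩
    · apply Set.eq_empty_of_subset_empty
      rintro x ⟨hxW, hx1, hx2⟩
      have hxu : x ∈ u := by
        rcases hx1 with h1 | h1
        · exact h1.1
        · exact hSu ⟨h1, hx2.2⟩
      have : x ∈ W \ D ∩ (u ∩ v) := ⟨⟨hxW, hx2.2⟩, hxu, hx2.1⟩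
      rw [hdisj] at this
      exact this
  · have h := hW ((v \ D) ∪ U) (u \ D) ((hv.sdiff hD).union hU) (hu.sdiff hD) ?_ ?_
    · rcases h with h | h
      · right
        intro x hx
        rcases h hx.1 with h1 | h1
        · exact h1.1
        · exact hSv ⟨h1, hx.2⟩
      · left
        exact fun x hx => (h hx.1).1
    · intro x hxW
      by_cases hxD : x ∈ D
      · exact Or.inl (Or.inr (hDU hxD))
      · rcases huv ⟨hxW, hxD⟩ with h1 | h1
        · exact Or.inr ⟨h1, hxD⟩
        · exact Or.inl (Or.inl ⟨h1, hxD⟩)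
    · apply Set.eq_empty_of_subset_empty
      rintro x ⟨hxW, hx1, hx2⟩
      have hxv : x ∈ v := by
        rcases hx1 with h1 | h1
        · exact h1.1
        · exact hSv ⟨h1, hx2.2⟩
      have : x ∈ W \ D ∩ (u ∩ v) := ⟨⟨hxW, hx2.2⟩, hx2.1, hxv⟩
      rw [hdisj] at this
      exact this

variable {n : ℕ}

/-- Local notation: `𝔼 n` is the model Euclidean space `EuclideanSpace ℝ (Fin n)`. -/
local notation "𝔼 " n:arg => EuclideanSpace ℝ (Fin n)

variable {M : Type*} [TopologicalSpace M] [T2Space M] [ChartedSpace (𝔼 n) M]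

/-- **Removing a closed disc from a preconnected set does not disconnect it** (dimension
`n ≥ 2`): for a disc `i : ℝⁿ → M` (a smooth embedding of `ℝⁿ`) with `range i ⊆ W`, `W`
preconnected, the set `W ∖ i(B̄(0, 1))` is preconnected — `range i` is an open neighbourhood of
the closed disc whose "puncture" `i({1 < ‖y‖})` is preconnected. [folklore] -/
theorem isPreconnected_diff_image_closedBall (hn : 2 ≤ n) {W : Set M} (hW : IsPreconnected W)
    {i : 𝔼 n → M} (hi : Manifold.IsSmoothEmbedding 𝓘(ℝ, 𝔼 n) (𝓡 n) ∞ i) (hiW : range i ⊆ W) :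
    IsPreconnected (W \ i '' closedBall (0 : 𝔼 n) 1) := by
  have hinj : Injective i := hi.isEmbedding.injective
  have hrank : 1 < Module.rank ℝ (𝔼 n) := by
    rw [← Module.finrank_eq_rank, finrank_euclideanSpace_fin]
    exact_mod_cast hn
  have hdiff : range i \ i '' closedBall (0 : 𝔼 n) 1 = i '' {y : 𝔼 n | 1 < ‖y‖} := by
    ext x
    constructor
    · rintro ⟨⟨y, rfl⟩, hx⟩
      refine ⟨y, ?_, rfl⟩
      by_contra hy
      exact hx ⟨y, by simpa using not_lt.mp hy, rfl⟩
    · rintro ⟨y, hy, rfl⟩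
      refine ⟨mem_range_self y, ?_⟩
      rintro ⟨z, hz, hzy⟩
      rw [hinj hzy] at hz
      simp only [mem_closedBall, dist_zero_right] at hz
      exact not_lt.mpr hz hy
  refine IsPreconnected.diff_of_isPreconnected_diff hW
    (((isCompact_closedBall (0 : 𝔼 n) 1).image hi.contMDiff.continuous).isClosed)
    (isOpen_range_of_isSmoothEmbedding_disc hi) (image_subset_range _ _) hiW ?_
  rw [hdiff]
  exact (isPreconnected_setOf_lt_norm hrank zero_le_one).image _ hi.contMDiff.continuous.continuousOn

end Connected

/-! ### Two discs -/

section TwoDiscs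

variable {EN HN : Type*} [NormedAddCommGroup EN] [NormedSpace ℝ EN] [TopologicalSpace HN]
  {J : ModelWithCorners ℝ EN HN} {N : Type*} [TopologicalSpace N] [ChartedSpace HN N]

/-- A diffeomorphism compactly diffeotopic to the identity inside `W` maps `W` into itself (it is
the identity off its support `K ⊆ W` and permutes `K`). [folklore] -/
theorem Diffeomorph.IsCompactlyDiffeotopicToIdIn.apply_mem {W : Set N} {φ : N ≃ₘ⟮J, J⟯ N}
    (h : Diffeomorph.IsCompactlyDiffeotopicToIdIn W φ) {x : N} (hx : x ∈ W) : φ x ∈ W := by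
  obtain ⟨D, K, -, hKW, hD, hDK⟩ := h
  have hφ : ∀ z, z ∉ K → φ z = z := fun z hz => by
    rw [← hD, Diffeotopy.coe_stage]; exact hDK 1 z hz
  by_cases hxK : x ∈ K
  · by_contra hφx
    have h1 : φ (φ x) = φ x := hφ _ fun h => hφx (hKW h)
    exact hφx (by rw [φ.injective h1]; exact hx)
  · rw [hφ x hxK]; exact hx

variable {n : ℕ}

/-- Local notation: `𝔼 n` is the model Euclidean space `EuclideanSpace ℝ (Fin n)`. -/
local notation "𝔼 " n:arg => EuclideanSpace ℝ (Fin n)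

variable {M : Type*} [TopologicalSpace M] [T2Space M] [ChartedSpace (𝔼 n) M]
  [IsManifold (𝓡 n) ∞ M]

/-- **The disc theorem for two disjoint discs, with a compactly supported diffeotopy** (Hirsch,
*Differential Topology* (1976), Ch. 8 §3, Thms. 3.1–3.2 for finitely many disjoint discs).  Let
`i₁, i₂ : ℝⁿ → M` be discs with disjoint images and `i₁', i₂'` discs with disjoint images, all
four preserving the orientations `(o₀, oM)` and lying in a preconnected open `W` of the Hausdorff
`n`-manifold `M`, `n ≥ 2`.  Then there is a diffeomorphism `f` of `M`, compactly diffeotopic to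
the identity inside `W`, with `f (i₁ y) = i₁' y` and `f (i₂ y) = i₂' y` for all `‖y‖ ≤ 1`.
Proof: move `i₁` onto `i₁'` by the one-disc theorem in `W`, then `f¹ ∘ i₂` onto `i₂'` by the
one-disc theorem in `W ∖ i₁'(B̄ⁿ)`, which is preconnected (`isPreconnected_diff_image_closedBall`)
and open; the second diffeomorphism fixes `i₁'(B̄ⁿ)` pointwise. [cite: HirschDT1976, Ch. 8 §3, Thms. 3.1–3.2] -/
theorem exists_isCompactlyDiffeotopicToIdIn_apply_two_discs_eq (hn : 2 ≤ n)
    {i₁ i₂ i₁' i₂' : 𝔼 n → M}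
    (hi₁ : Manifold.IsSmoothEmbedding 𝓘(ℝ, 𝔼 n) (𝓡 n) ∞ i₁)
    (hi₂ : Manifold.IsSmoothEmbedding 𝓘(ℝ, 𝔼 n) (𝓡 n) ∞ i₂)
    (hi₁' : Manifold.IsSmoothEmbedding 𝓘(ℝ, 𝔼 n) (𝓡 n) ∞ i₁')
    (hi₂' : Manifold.IsSmoothEmbedding 𝓘(ℝ, 𝔼 n) (𝓡 n) ∞ i₂')
    {o₀ : Orientation ℝ (𝔼 n) (Fin (finrank ℝ (𝔼 n)))} {oM : SmoothOrientation (𝓡 n) M}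
    (ho₁ : IsOrientationPreserving (SmoothOrientation.modelSpace o₀) oM i₁)
    (ho₂ : IsOrientationPreserving (SmoothOrientation.modelSpace o₀) oM i₂)
    (ho₁' : IsOrientationPreserving (SmoothOrientation.modelSpace o₀) oM i₁')
    (ho₂' : IsOrientationPreserving (SmoothOrientation.modelSpace o₀) oM i₂')
    (hd : Disjoint (range i₁) (range i₂)) (hd' : Disjoint (range i₁') (range i₂'))
    {W : Set M} (hWo : IsOpen W) (hWc : IsPreconnected W)
    (h₁W : range i₁ ⊆ W) (h₂W : range i₂ ⊆ W) (h₁'W : range i₁' ⊆ W) (h₂'W : range i₂' ⊆ W) :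
    ∃ f : M ≃ₘ⟮𝓡 n, 𝓡 n⟯ M, Diffeomorph.IsCompactlyDiffeotopicToIdIn W f ∧
      (∀ y : 𝔼 n, ‖y‖ ≤ 1 → f (i₁ y) = i₁' y) ∧ ∀ y : 𝔼 n, ‖y‖ ≤ 1 → f (i₂ y) = i₂' y := by
  -- Step 1: the first disc
  obtain ⟨f₁, hf₁d, hf₁⟩ :=
    exists_isCompactlyDiffeotopicToIdIn_apply_disc_eq hi₁ hi₁' ho₁ ho₁' hWo hWc h₁W h₁'W
  -- Step 2: the second disc, inside `W₂ = W \ i₁'(B̄)`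
  set D : Set M := i₁' '' closedBall (0 : 𝔼 n) 1 with hD_def
  set W₂ : Set M := W \ D with hW₂_def
  have hDc : IsClosed D := ((isCompact_closedBall (0 : 𝔼 n) 1).image hi₁'.contMDiff.continuous).isClosed
  have hW₂o : IsOpen W₂ := hWo.sdiff hDc
  have hW₂c : IsPreconnected W₂ := isPreconnected_diff_image_closedBall hn hWc hi₁' h₁'W
  set j₂ : 𝔼 n → M := f₁ ∘ i₂ with hj₂_def
  have hj₂ : Manifold.IsSmoothEmbedding 𝓘(ℝ, 𝔼 n) (𝓡 n) ∞ j₂ := hi₂.diffeomorph_comp f₁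
  have hoj₂ : IsOrientationPreserving (SmoothOrientation.modelSpace o₀) oM j₂ :=
    IsOrientationPreserving.comp_holds (hf₁d.isDiffeotopicToId.isOrientationPreserving oM) ho₂
      (f₁.mdifferentiable (by simp)) (fun y => (hi₂.contMDiff y).mdifferentiableAt (by simp))
      (fun x => f₁.det_mfderiv_ne_zero (by simp) x)
      (fun y => det_mfderiv_ne_zero_of_isSmoothEmbedding hi₂ (isOpen_range_of_isSmoothEmbedding_disc hi₂) y)
  have hj₂W : range j₂ ⊆ W₂ := by
    rintro _ ⟨y, rfl⟩
    refine ⟨hf₁d.apply_mem (h₂W (mem_range_self y)), ?_⟩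
    rintro ⟨z, hz, hzy⟩
    have h1 : f₁ (i₁ z) = f₁ (i₂ y) := by
      rw [hf₁ z (by simpa using hz)]; exact hzy
    exact hd.ne_of_mem (mem_range_self z) (mem_range_self y) (f₁.injective h1)
  have hi₂'W : range i₂' ⊆ W₂ := by
    rintro _ ⟨y, rfl⟩
    refine ⟨h₂'W (mem_range_self y), ?_⟩
    rintro ⟨z, -, hzy⟩
    exact hd'.ne_of_mem (mem_range_self z) (mem_range_self y) hzy
  obtain ⟨f₂, hf₂d, hf₂⟩ :=
    exists_isCompactlyDiffeotopicToIdIn_apply_disc_eq hj₂ hi₂' hoj₂ ho₂' hW₂o hW₂c hj₂W hi₂'W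
  -- `f₂` fixes the first disc pointwise
  have hf₂D : ∀ y : 𝔼 n, ‖y‖ ≤ 1 → f₂ (i₁' y) = i₁' y := fun y hy =>
    hf₂d.apply_eq_self fun h => h.2 ⟨y, by simpa using hy, rfl⟩
  refine ⟨f₁.trans f₂, hf₁d.trans (hf₂d.mono fun x hx => hx.1), fun y hy => ?_, fun y hy => ?_⟩
  · rw [Diffeomorph.coe_trans, Function.comp_apply, hf₁ y hy, hf₂D y hy]
  · rw [Diffeomorph.coe_trans, Function.comp_apply]
    exact hf₂ y hy

end TwoDiscs

end Literature.Topology.FourManifolds
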